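import Summits.ResolutionOfSingularities.ResolutionOfSingularities.Theorems.EquisingularLiftEquisingularLiftNatChartLiftData
import Summits.ResolutionOfSingularities.ResolutionOfSingularities.Theorems.EquisingularLiftEquisingularLiftNatChartLiftTorsorAction
import Summits.ResolutionOfSingularities.ResolutionOfSingularities.Theorems.EquisingularLiftEquisingularLiftNatChartCocycleCorrection
import Summits.ResolutionOfSingularities.ResolutionOfSingularities.Theorems.EquisingularLiftEquisingularLiftNatIdealSheafGlueFamily
import Summits.ResolutionOfSingularities.ResolutionOfSingularities.Theorems.EquisingularLiftEquisingularLiftNatFlatOnCharts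
import Literature.AlgebraicGeometry.Morphisms.CechModuleCoverIndependence
import Literature.AlgebraicGeometry.Modules.SheafHomCoh
import HarnessLib

/-!
# [OURS · L1 W4.5(b) · EL♮(3) · J1c (π) brick F6b, part 1] Trace charts and difference sections of chart lifts (F5 on the trace charts)

Crux chain w45b (cell `res-hironaka`, slot W4.5(b)), child crux **EL♮(3)** = stmt-ResolutionOfSingularities-20148; J1 = `EmbeddedInfinitesimalLiftFact`
(p596985), discharge programme J1c, brick **(π)** (patching engine, res-type-027 g17; object split STATUS 2026-08-28T05:26Z, CHAIN v7.49 §7). OURS; NOT a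
statement of H. Hironaka's 2017 manuscript; AI-written, gate-checked, weaker than expert review. No `sorry`; standard axioms. Definitions `traceChart`,
`HasLciTrace` (review lane). `--supports stmt-ResolutionOfSingularities-20148 --as helper`. THIS PART: the trace charts `traceChart`, the lci predicate
`HasLciTrace`, and the chart-level wrappers of F5 (`existsUnique_isDiffSec_of_isChartLift`, `isDiffSec_restrict_of_isChartLift`, `isDiffSec_add_of_isChartLift`,
`isDiffSec_neg_of_isChartLift`, `eq_of_isDiffSec_zero_of_isChartLift`, `exists_isChartLift_isDiffSec`); the patching theorem itself is in the sequel …NatChartLiftPatching.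

This is R. Hartshorne, *Deformation Theory* (2010), proof of Thm. 6.2 (b) («… the differences define a Čech 1-cocycle … if it is a coboundary we can
modify the local choices so that they glue»), for one principal small extension `X_n ↪ X_{n+1}` of infinitesimal neighbourhoods (general tower
`f : X ⟶ Spec A`, `I`, fibre model `(j₀, t₀)` over `q : A ↠ k₀`; J1's instance `A = O` a DVR): GIVEN chart lifts of `Y_n ↪ X_n` on small affine charts
covering `X_{n+1}` (F6a `IsChartLift`; supplied at the points of `Y₀` by res-L1-w45b-stub-4's B4 `exists_affine_chartLift` p610186), and
`Ȟ¹ = 0` for the normal sheaf `𝒩` of `ι : Y₀ ↪ X₀` on a two-piece affine cover, THERE IS an ideal sheaf `C` on `X_{n+1}` with `C.comap t = jn.ker` and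
`V(C) → Spec (A/I^{n+2})` flat — the input of (γ♯) `exists_closedImmersion_flat_isPullback_of_idealSheafData` (p602990).
Assembly: difference sections of restricted lifts on the affine sub-charts (F5 `exists_isDiffSec`, unique, restricting by `isDiffSec_restrict`,
additive by `isDiffSec_add`) ⟶ a Čech 1-cocycle of `𝒩` on the traces (res-L1-w45b-lead-1's F6-core `exists_cochain_of_chart_differences`,
p609951, over F2) ⟶ a coboundary (J1's `Subsingleton (CechMH1 …)` through the tree's `cechMZ1_le_cechMB1_of_refine`) ⟶ corrected lifts
(F5 `exists_lift_isDiffSec`) agreeing on overlaps (F5 `eq_of_isDiffSec_zero`) ⟶ glued ideal sheaf (F3 `exists_idealSheafData_forall_ideal_eq_family`)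
⟶ `comap t = jn.ker` and flatness on the chart cover (B1 `comap_ideal_chart`, B2's chart argument).

References (method / index only): R. Hartshorne, *Deformation Theory* (2010), Thm. 6.2 and its proof pp. 47–49; R. Hartshorne, *Algebraic Geometry*
(1977), III §4.
-/

set_option linter.dupNamespace false -- mandated namespace `Summit.<Summit>.<Problem>` of this single-conjunct summit
-- `TopCat.Presheaf`/`Scheme.Modules` are not reducible (as in Mathlib's `AlgebraicGeometry/Modules` and the tree's `Modules/*`).
set_option backward.isDefEq.respectTransparency false

noncomputable section

open CategoryTheory CategoryTheory.Limits AlgebraicGeometry Opposite TopologicalSpace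
open Literature.AlgebraicGeometry.Morphisms Literature.AlgebraicGeometry.Modules Literature.AlgebraicGeometry.Deformation
open Literature.AlgebraicGeometry.HodgeTheory

namespace Summit.ResolutionOfSingularities.ResolutionOfSingularities.Cruxes.EquisingularLiftNat.Sections

universe u

/-! ## Generic bookkeeping -/

/-- Restriction of ideals along the identity of an affine open is the identity. [folklore] -/
theorem ideal_map_presheaf_map_refl {X : Scheme.{0}} (U : X.affineOpens) (J : Ideal Γ(X, U)) :
    J.map (X.presheaf.map (homOfLE (le_refl (U : X.Opens))).op).hom = J := by
  have h : (homOfLE (le_refl (U : X.Opens))).op = 𝟙 _ := rfl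
  rw [h, X.presheaf.map_id]
  exact Ideal.map_id J

/-- A subsingleton `Ȟ¹` means every cocycle is a coboundary. [folklore] -/
theorem cechMZ1_le_cechMB1_of_subsingleton {A : Type u} [CommRing A] {Y : Scheme.{u}} (g : Y ⟶ Spec (.of A)) (M : Y.Modules) {J : Type}
    (V : J → Y.Opens) [Subsingleton (CechMH1 g M V)] : cechMZ1 g M V ≤ cechMB1 g M V := fun z hz =>
  (CechMH1.mk_eq_zero_iff g M V ⟨z, hz⟩).mp (Subsingleton.elim _ _)

/-! ## The trace charts and the small charts -/

section Charts

variable {A : Type} [CommRing A] (I : Ideal A) {X : Scheme.{0}} (f : X ⟶ Spec (.of A)) (n : ℕ) {k₀ : Type} [CommRing k₀] (q : A →+* k₀)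
  (hq : Function.Surjective q) (hI : I ≤ RingHom.ker q) {X₀ : Scheme.{0}} {j₀ : X₀ ⟶ X} {t₀ : X₀ ⟶ Spec (.of k₀)}
  (hsq : IsPullback j₀ t₀ f (Spec.map (CommRingCat.ofHom q))) {Y₀ : Scheme.{0}} (ι : Y₀ ⟶ X₀)

/-- **The trace chart** `fibreEmb⁻¹(t⁻¹U) ⊆ X₀` of an affine chart `U ⊆ X_{n+1}` (affine: both maps are closed immersions). [folklore] -/
def traceChart (U : (infinitesimalNeighbourhood I f (n + 1)).affineOpens) : X₀.affineOpens :=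
  haveI := isClosedImmersion_fibreEmb I f q hI hsq hq n
  haveI := isClosedImmersion_transition I f n
  ⟨fibreEmb I f q hI hsq n ⁻¹ᵁ ((infinitesimalNeighbourhood.transition I f n) ⁻¹ᵁ (U : (infinitesimalNeighbourhood I f (n + 1)).Opens)),
    (U.2.preimage _).preimage _⟩

/-- The open of the trace chart. [folklore] -/
theorem coe_traceChart (U : (infinitesimalNeighbourhood I f (n + 1)).affineOpens) :
    (traceChart I f n q hq hI hsq U : X₀.Opens) =
      fibreEmb I f q hI hsq n ⁻¹ᵁ ((infinitesimalNeighbourhood.transition I f n) ⁻¹ᵁ (U : (infinitesimalNeighbourhood I f (n + 1)).Opens)) :=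
  rfl

/-- Trace charts are monotone. [folklore] -/
theorem traceChart_mono {U U' : (infinitesimalNeighbourhood I f (n + 1)).affineOpens} (h : (U' : (infinitesimalNeighbourhood I f (n + 1)).Opens) ≤ U) :
    (traceChart I f n q hq hI hsq U' : X₀.Opens) ≤ traceChart I f n q hq hI hsq U :=
  (fibreEmb I f q hI hsq n).preimage_mono ((infinitesimalNeighbourhood.transition I f n).preimage_mono h)

/-- **`HasLciTrace U`**: the ideal of `ι : Y₀ ↪ X₀` on the trace chart of `U` is generated by a weakly regular sequence (J1's lci clause, read on the
trace chart). [OURS · predicate of the (π) engine; NOT a statement of a source] -/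
def HasLciTrace (U : (infinitesimalNeighbourhood I f (n + 1)).affineOpens) : Prop :=
  ∃ (m : ℕ) (x : Fin m → Γ(X₀, (traceChart I f n q hq hI hsq U : X₀.Opens))),
    RingTheory.Sequence.IsWeaklyRegular Γ(X₀, (traceChart I f n q hq hI hsq U : X₀.Opens)) (List.ofFn x) ∧
      Ideal.span (Set.range x) = ι.ker.ideal (traceChart I f n q hq hI hsq U)

variable {I f n q hq hI hsq ι}

/-- `HasLciTrace` passes to smaller affine charts (B3). [folklore] -/
theorem HasLciTrace.mono [IsClosedImmersion ι] {U U' : (infinitesimalNeighbourhood I f (n + 1)).affineOpens}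
    (h : (U' : (infinitesimalNeighbourhood I f (n + 1)).Opens) ≤ U) (hU : HasLciTrace I f n q hq hI hsq ι U) : HasLciTrace I f n q hq hI hsq ι U' := by
  obtain ⟨m, x, hreg, hI₀⟩ := hU
  obtain ⟨hreg', hI'⟩ := isWeaklyRegular_and_span_eq_of_le ι (V := traceChart I f n q hq hI hsq U) (V' := traceChart I f n q hq hI hsq U')
    (traceChart_mono I f n q hq hI hsq h) x hreg hI₀
  exact ⟨m, _, hreg', hI'⟩

end Charts

/-! ## The difference sections of chart lifts (F5 instantiated on the trace charts) -/

section Diff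

variable {A : Type} [CommRing A] {I : Ideal A} {X : Scheme.{0}} {f : X ⟶ Spec (.of A)} {n : ℕ} {k₀ : Type} [CommRing k₀] {q : A →+* k₀}
  {hq : Function.Surjective q} {hI : I ≤ RingHom.ker q} {X₀ : Scheme.{0}} {j₀ : X₀ ⟶ X} {t₀ : X₀ ⟶ Spec (.of k₀)}
  {hsq : IsPullback j₀ t₀ f (Spec.map (CommRingCat.ofHom q))} {Yn Y₀ : Scheme.{0}} {jn : Yn ⟶ infinitesimalNeighbourhood I f n}
  [IsClosedImmersion jn] {ι : Y₀ ⟶ X₀} [IsClosedImmersion ι] [IsLocallyNoetherian X₀] {s₀ : Y₀ ⟶ Yn}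
  (hs₀ : IsPullback s₀ ι (jn ≫ infinitesimalNeighbourhood.ι I f n) j₀)
  {ε : A ⧸ I ^ (n + 1 + 1)} (hkert : RingHom.ker (infinitesimalNeighbourhood.transitionRingHom I n) = Ideal.span {ε})
  (hann : ∀ c : A ⧸ I ^ (n + 1 + 1), ε * c = 0 ↔ c ∈ (RingHom.ker q).map (Ideal.Quotient.mk (I ^ (n + 1 + 1))))
  (hεm : ε ∈ (RingHom.ker q).map (Ideal.Quotient.mk (I ^ (n + 1 + 1))))

include hs₀ hkert hann hεm in
/-- **Existence and uniqueness of the difference section of two chart lifts on a small chart.** [cite: Hartshorne2010, Thm. 6.2 (a) (proof, affine case)] -/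
theorem existsUnique_isDiffSec_of_isChartLift {U : (infinitesimalNeighbourhood I f (n + 1)).affineOpens} (hl : HasLciTrace I f n q hq hI hsq ι U)
    {J J' : Ideal Γ(infinitesimalNeighbourhood I f (n + 1), U)} (hJ : IsChartLift I f n jn U J) (hJ' : IsChartLift I f n jn U J') :
    letI := chartAlg I f (n + 1) U
    ∃! μ : (conormalSheaf ι).over (ι ⁻¹ᵁ (traceChart I f n q hq hI hsq U : X₀.Opens)) ⟶
        (unitModule Y₀).over (ι ⁻¹ᵁ (traceChart I f n q hq hI hsq U : X₀.Opens)),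
      IsDiffSec ι ε (traceHom I f n q hI hsq U) J J' μ := by
  letI := chartAlg I f (n + 1) U
  haveI := hJ.flat
  haveI := hJ'.flat
  obtain ⟨m, x, hreg, hI₀⟩ := hl
  have hπ := traceHom_surjective I f n q hq hI hsq U
  have hkerπ := ker_traceHom I f n q hq hI hsq hkert hεm U
  have hJπ := hJ.map_traceHom I f n q hq hI hsq hs₀
  have hJ'π := hJ'.map_traceHom I f n q hq hI hsq hs₀
  have hle := hJ.le_sup_span hkert hJ'
  obtain ⟨μ, hμ⟩ := exists_isDiffSec ι hann (V := traceChart I f n q hq hI hsq U) x hreg hI₀ (traceHom I f n q hI hsq U) hπ hkerπ J J' hJπ hJ'π hle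
  exact ⟨μ, hμ, fun μ' hμ' => isDiffSec_unique ι (V := traceChart I f n q hq hI hsq U) x hreg hI₀ (traceHom I f n q hI hsq U) hπ hJπ hle hμ' hμ⟩

include hs₀ hkert hann hεm in
/-- **Difference sections restrict**: along an affine `U' ≤ U`, the difference section of the restricted lifts is the restriction. [folklore] -/
theorem isDiffSec_restrict_of_isChartLift {U U' : (infinitesimalNeighbourhood I f (n + 1)).affineOpens}
    (hle : (U' : (infinitesimalNeighbourhood I f (n + 1)).Opens) ≤ U) (hl : HasLciTrace I f n q hq hI hsq ι U)
    {J J' : Ideal Γ(infinitesimalNeighbourhood I f (n + 1), U)} (hJ : IsChartLift I f n jn U J) (hJ' : IsChartLift I f n jn U J')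
    {μ : (conormalSheaf ι).over (ι ⁻¹ᵁ (traceChart I f n q hq hI hsq U : X₀.Opens)) ⟶ (unitModule Y₀).over (ι ⁻¹ᵁ (traceChart I f n q hq hI hsq U : X₀.Opens))}
    (hμ : letI := chartAlg I f (n + 1) U; IsDiffSec ι ε (traceHom I f n q hI hsq U) J J' μ) :
    letI := chartAlg I f (n + 1) U'
    IsDiffSec ι ε (traceHom I f n q hI hsq U') (J.map ((infinitesimalNeighbourhood I f (n + 1)).presheaf.map (homOfLE hle).op).hom)
      (J'.map ((infinitesimalNeighbourhood I f (n + 1)).presheaf.map (homOfLE hle).op).hom)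
      (restrictHom (homOfLE (ι.preimage_mono (traceChart_mono I f n q hq hI hsq hle))) μ) := by
  letI := chartAlg I f (n + 1) U
  letI := chartAlg I f (n + 1) U'
  haveI := hJ.flat
  haveI := hJ'.flat
  haveI : Module.Flat (A ⧸ I ^ (n + 1 + 1)) (Γ(infinitesimalNeighbourhood I f (n + 1), U') ⧸ J.map (resAlgHom I f (n + 1) hle)) :=
    (hJ.restrict hle).flat
  haveI : Module.Flat (A ⧸ I ^ (n + 1 + 1)) (Γ(infinitesimalNeighbourhood I f (n + 1), U') ⧸ J'.map (resAlgHom I f (n + 1) hle)) :=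
    (hJ'.restrict hle).flat
  obtain ⟨m, x, hreg, hI₀⟩ := hl
  exact isDiffSec_restrict ι hann (V := traceChart I f n q hq hI hsq U) (V₁ := traceChart I f n q hq hI hsq U') (traceChart_mono I f n q hq hI hsq hle)
    x hreg hI₀ (traceHom I f n q hI hsq U) (traceHom_surjective I f n q hq hI hsq U) (resAlgHom I f (n + 1) hle) (traceHom I f n q hI hsq U')
    (traceHom_surjective I f n q hq hI hsq U') (ker_traceHom I f n q hq hI hsq hkert hεm U')
    (fun a => traceHom_res I f n q hI hsq hle a) J J' (hJ.map_traceHom I f n q hq hI hsq hs₀) (hJ'.map_traceHom I f n q hq hI hsq hs₀)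
    (hJ.le_sup_span hkert hJ') hμ

omit [IsLocallyNoetherian X₀] in
include hs₀ hkert hann hεm in
/-- **Additivity of difference sections over a third chart lift** (F5 `isDiffSec_add` on a small chart). [folklore] -/
theorem isDiffSec_add_of_isChartLift {U : (infinitesimalNeighbourhood I f (n + 1)).affineOpens}
    {J₁ J₂ J₃ : Ideal Γ(infinitesimalNeighbourhood I f (n + 1), U)} (h₁ : IsChartLift I f n jn U J₁) (h₂ : IsChartLift I f n jn U J₂)
    (h₃ : IsChartLift I f n jn U J₃)
    {μ μ' : (conormalSheaf ι).over (ι ⁻¹ᵁ (traceChart I f n q hq hI hsq U : X₀.Opens)) ⟶ (unitModule Y₀).over (ι ⁻¹ᵁ (traceChart I f n q hq hI hsq U : X₀.Opens))}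
    (hμ : letI := chartAlg I f (n + 1) U; IsDiffSec ι ε (traceHom I f n q hI hsq U) J₁ J₂ μ)
    (hμ' : letI := chartAlg I f (n + 1) U; IsDiffSec ι ε (traceHom I f n q hI hsq U) J₂ J₃ μ') :
    letI := chartAlg I f (n + 1) U; IsDiffSec ι ε (traceHom I f n q hI hsq U) J₁ J₃ (μ + μ') := by
  letI := chartAlg I f (n + 1) U
  haveI := h₁.flat
  haveI := h₃.flat
  exact isDiffSec_add ι hann hεm (V := traceChart I f n q hq hI hsq U) (traceHom I f n q hI hsq U) (ker_traceHom I f n q hq hI hsq hkert hεm U) J₁ J₂ J₃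
    (h₃.map_traceHom I f n q hq hI hsq hs₀) (h₁.le_sup_span hkert h₂) (h₂.le_sup_span hkert h₃) (h₁.le_sup_span hkert h₃) hμ hμ'

omit [IsClosedImmersion ι] [IsLocallyNoetherian X₀] in
include hkert hεm in
/-- **Antisymmetry of difference sections** (F5 `isDiffSec_neg` on a small chart). [folklore] -/
theorem isDiffSec_neg_of_isChartLift {U : (infinitesimalNeighbourhood I f (n + 1)).affineOpens}
    {J₁ J₂ : Ideal Γ(infinitesimalNeighbourhood I f (n + 1), U)}
    {μ : (conormalSheaf ι).over (ι ⁻¹ᵁ (traceChart I f n q hq hI hsq U : X₀.Opens)) ⟶ (unitModule Y₀).over (ι ⁻¹ᵁ (traceChart I f n q hq hI hsq U : X₀.Opens))}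
    (hμ : letI := chartAlg I f (n + 1) U; IsDiffSec ι ε (traceHom I f n q hI hsq U) J₁ J₂ μ) :
    letI := chartAlg I f (n + 1) U; IsDiffSec ι ε (traceHom I f n q hI hsq U) J₂ J₁ (-μ) := by
  letI := chartAlg I f (n + 1) U
  exact isDiffSec_neg ι hεm (V := traceChart I f n q hq hI hsq U) (traceHom I f n q hI hsq U) (ker_traceHom I f n q hq hI hsq hkert hεm U) J₁ J₂ hμ

omit [IsLocallyNoetherian X₀] in
include hq hs₀ hkert hann hεm in
/-- **Detection on a small chart**: two chart lifts with difference section `0` are equal (F5 `eq_of_isDiffSec_zero`; `𝔪` nilpotent). [folklore] -/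
theorem eq_of_isDiffSec_zero_of_isChartLift (hnil : IsNilpotent ((RingHom.ker q).map (Ideal.Quotient.mk (I ^ (n + 1 + 1)))))
    {U : (infinitesimalNeighbourhood I f (n + 1)).affineOpens} {J₁ J₂ : Ideal Γ(infinitesimalNeighbourhood I f (n + 1), U)}
    (h₁ : IsChartLift I f n jn U J₁) (h₂ : IsChartLift I f n jn U J₂)
    (h0 : letI := chartAlg I f (n + 1) U; IsDiffSec ι ε (traceHom I f n q hI hsq U) J₁ J₂ 0) : J₁ = J₂ := by
  letI := chartAlg I f (n + 1) U
  haveI := h₂.flat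
  exact eq_of_isDiffSec_zero ι hann hεm (V := traceChart I f n q hq hI hsq U) (traceHom I f n q hI hsq U) (traceHom_surjective I f n q hq hI hsq U)
    (ker_traceHom I f n q hq hI hsq hkert hεm U) hnil J₁ J₂ (h₁.map_traceHom I f n q hq hI hsq hs₀) (h₂.map_traceHom I f n q hq hI hsq hs₀)
    (h₁.le_sup_span hkert h₂) (h₂.le_sup_span hkert h₁) h0

omit [IsLocallyNoetherian X₀] in
include hs₀ hkert hann hεm in
/-- **The torsor action on a small chart**: every section of `𝒩` over the trace is the difference section of `J` and some chart lift
(F5 `exists_lift_isDiffSec` + F6a `isChartLift_of_sup_span_eq`). [cite: Hartshorne2010, Thm. 6.2 (a) (proof, affine case)] -/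
theorem exists_isChartLift_isDiffSec {U : (infinitesimalNeighbourhood I f (n + 1)).affineOpens}
    {J : Ideal Γ(infinitesimalNeighbourhood I f (n + 1), U)} (hJ : IsChartLift I f n jn U J)
    (μ : (conormalSheaf ι).over (ι ⁻¹ᵁ (traceChart I f n q hq hI hsq U : X₀.Opens)) ⟶ (unitModule Y₀).over (ι ⁻¹ᵁ (traceChart I f n q hq hI hsq U : X₀.Opens))) :
    ∃ J' : Ideal Γ(infinitesimalNeighbourhood I f (n + 1), U), IsChartLift I f n jn U J' ∧
      letI := chartAlg I f (n + 1) U; IsDiffSec ι ε (traceHom I f n q hI hsq U) J J' μ := by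
  letI := chartAlg I f (n + 1) U
  haveI := hJ.flat
  obtain ⟨J', hflat, hsup, -, hdiff⟩ := exists_lift_isDiffSec ι hann hεm (V := traceChart I f n q hq hI hsq U) (traceHom I f n q hI hsq U)
    (traceHom_surjective I f n q hq hI hsq U)
    (ker_traceHom I f n q hq hI hsq hkert hεm U) J (hJ.map_traceHom I f n q hq hI hsq hs₀) μ
  exact ⟨J', isChartLift_of_sup_span_eq hkert hJ hflat hsup, hdiff⟩

end Diff

end Summit.ResolutionOfSingularities.ResolutionOfSingularities.Cruxes.EquisingularLiftNat.Sections

end
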